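import Summits.QuantumFields.YangMills.Theses.LangevinControlUV
import Literature.MathematicalPhysics.QuantumFieldTheory.AbelianVortexClustering

/-!
# `FemtoCurvatureTwoPoint` — Peierls bookkeeping for finite abelian gauge groups on the torus
# `(ℤ/8)⁴` (support file for `Negative.FiniteGroupFalse`)

Negative-side support for crux `Summit.QuantumFields.YangMills.Theses.LangevinControlUV.
FemtoCurvatureTwoPoint` (item stmt-QuantumFields-9363; cdisprove gen 1). The crux's shared shape
function `Γ` forces, at equal `β`, every plaquette pair at torus distance `1` to be dominated by
ONE constant times the reference axis pair `(P_0^{01}, P_{e₂}^{01})`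
(crux workfile `Disproof.lean`, `PackageWith.eventually_ratio`). For a FINITE abelian gauge
group this fails: the pair `(P_0^{02}, P_{e₂}^{01})` shares the link `(e₂, 0)` and is excited by a
single vortex of `6` plaquettes (`Θ(ε⁶)`, `ε = e^{-βδ}`), whereas a closed vortex configuration
exciting BOTH reference plaquettes `p₀ = (0; 0,1)` and `p₁ = (e₂; 0,1)` either has a cube-connected
component through both of at least `8` plaquettes, or two components of at least `5` plaquettes
each (`O(ε⁸)`). This file supplies the combinatorics and the Peierls sums, in the vortex-gas
language of the tree (`AbelianContourGas`, `AbelianVortexClustering`):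

* `peierlsSum_le_pow` — the Peierls sum `∑_{X connected, #X ≥ M} λ^{#X}` is `O(λ^M)`
  (`≤ #plaquettes · 2T · (λ/T)^M` for `λ ≤ T`, `(Δ+1)² T ≤ 1/2`);
* `sum_closed_le_two`, `one_le_sum_closed`, `one_le_sum_Img`, `sum_Img_le_sum_closed` — the
  closed / exact partition sums lie in `[1, 2]` once `δ(λ, 1) ≤ 1/2`;
* `ne_zero_face₃/₄/₅/₆` — a closed configuration non-zero on one face of a `3`-cell is non-zero
  on another face of it;
* `le_card_of_meets_disjoint_regions/list` — a set meeting `m` pairwise disjoint regions has at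
  least `m` elements (how vortex sizes are bounded below in `Negative.FiniteGroupVortices`).

Sequel files: `Negative.FiniteGroupVortices` (vortices through the reference plaquettes of
`(ℤ/8)⁴` have `≥ 5`, resp. `≥ 8` plaquettes), `Negative.FiniteGroupTwoPlaquettes` (the closed
weight exciting both reference plaquettes is `O(λ⁸)`), `Negative.FiniteGroupFalse` (the kill).
-/

noncomputable section

open Finset Function
open Literature.MathematicalPhysics.QuantumFieldTheory
open Literature.MathematicalPhysics.QuantumFieldTheory.LatticeForm
open Literature.Probability.LatticeModels (IsRConnected rcomponent rcomponents mem_rcomponent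
  rcomponent_subset mem_rcomponent_self rcomponent_eq_of_mem isRConnected_rcomponent
  mem_rcomponents_iff sum_pow_card_le_of_connected)

namespace Summit.QuantumFields.YangMills.Theorems.FemtoCurvatureTwoPoint.Negative.FiniteGroupPeierls

/- The vortex-gas finsets are `Finset.univ.filter …` over ALL plaquette configurations; at the
concrete torus `L = 8` the unifier must never unfold them (it would enumerate the torus), so they
are made irreducible for the elaboration of this file. -/
attribute [local irreducible] psupp Closed Fib connSets

/-! ### The Peierls sum is `O(λ^M)` -/

section PeierlsPow

variable {d L : ℕ} [NeZero L]

/-- **The Peierls sum is `O(λ^M)`**: for `0 ≤ λ ≤ T` with `(Δ+1)² T ≤ 1/2`,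
`∑_{X connected, #X ≥ M} λ^{#X} ≤ #plaquettes · 2T · (λ/T)^M` (write
`λ^{#X} = (λ/T)^{#X} T^{#X} ≤ (λ/T)^M T^{#X}` and use the lattice-animal bound
`∑_{X ∋ q connected} T^{#X} ≤ 2T`). -/
theorem peierlsSum_le_pow {lam T : ℝ} (hlam : 0 ≤ lam) (hlamT : lam ≤ T) (hT : 0 < T)
    (hsmall : ((cubeDeg d : ℝ) + 1) ^ 2 * T ≤ 1 / 2) (M : ℕ) :
    peierlsSum d L lam M ≤ Fintype.card (Plaquette d L) * (2 * T) * (lam / T) ^ M := by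
  classical
  set S := (connSets d L).filter (fun X => M ≤ X.card) with hS
  have h1 : peierlsSum d L lam M ≤
      ∑ q : Plaquette d L, ∑ X ∈ S.filter (fun X => q ∈ X), lam ^ X.card := by
    unfold peierlsSum
    rw [← hS]
    calc ∑ X ∈ S, lam ^ X.card
        ≤ ∑ X ∈ S, ∑ q : Plaquette d L, (if q ∈ X then lam ^ X.card else 0) := by
          refine Finset.sum_le_sum fun X hX => ?_
          obtain ⟨q, hq⟩ := (mem_connSets.1 (Finset.mem_filter.1 hX).1).1
          rw [← Finset.sum_erase_add _ _ (Finset.mem_univ q)]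
          simp only [hq, if_true]
          have : 0 ≤ ∑ x ∈ Finset.univ.erase q, (if x ∈ X then lam ^ X.card else 0) :=
            Finset.sum_nonneg fun x _ => by split_ifs <;> positivity
          linarith
      _ = ∑ q : Plaquette d L, ∑ X ∈ S, (if q ∈ X then lam ^ X.card else 0) := Finset.sum_comm
      _ = ∑ q : Plaquette d L, ∑ X ∈ S.filter (fun X => q ∈ X), lam ^ X.card :=
          Finset.sum_congr rfl fun q _ => (Finset.sum_filter (fun X => q ∈ X) _).symm
  refine h1.trans ?_
  have hratio0 : 0 ≤ lam / T := div_nonneg hlam hT.le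
  have hratio1 : lam / T ≤ 1 := (div_le_one hT).2 hlamT
  have h2 : ∀ q : Plaquette d L,
      ∑ X ∈ S.filter (fun X => q ∈ X), lam ^ X.card ≤ 2 * T * (lam / T) ^ M := by
    intro q
    have hΔ : ∀ p : Plaquette d L, (cubeNbr p).card ≤ cubeDeg d := fun p => card_cubeNbr_le p
    have hanimal := sum_pow_card_le_of_connected (R := CubeAdj) (nbr := cubeNbr) (Δ := cubeDeg d)
      (fun _ _ => cubeAdj_symm) hΔ (fun _ _ h => mem_cubeNbr_of_cubeAdj h) (lam := T) hT.le
      hsmall q (S.filter fun X => q ∈ X) (fun Y hY => by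
        rw [Finset.mem_filter] at hY
        exact ⟨hY.2, mem_connSets.1 (Finset.mem_filter.1 hY.1).1⟩)
    calc ∑ X ∈ S.filter (fun X => q ∈ X), lam ^ X.card
        ≤ ∑ X ∈ S.filter (fun X => q ∈ X), (lam / T) ^ M * T ^ X.card := by
          refine Finset.sum_le_sum fun X hX => ?_
          have hM : M ≤ X.card := (Finset.mem_filter.1 (Finset.mem_filter.1 hX).1).2
          calc lam ^ X.card = (lam / T) ^ X.card * T ^ X.card := by
                rw [← mul_pow, div_mul_cancel₀ _ hT.ne']
            _ ≤ (lam / T) ^ M * T ^ X.card :=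
                mul_le_mul_of_nonneg_right (pow_le_pow_of_le_one hratio0 hratio1 hM)
                  (pow_nonneg hT.le _)
      _ = (lam / T) ^ M * ∑ X ∈ S.filter (fun X => q ∈ X), T ^ X.card := by rw [Finset.mul_sum]
      _ ≤ (lam / T) ^ M * (2 * T) := mul_le_mul_of_nonneg_left hanimal (pow_nonneg hratio0 _)
      _ = 2 * T * (lam / T) ^ M := by ring
  calc ∑ q : Plaquette d L, ∑ X ∈ S.filter (fun X => q ∈ X), lam ^ X.card
      ≤ ∑ _q : Plaquette d L, 2 * T * (lam / T) ^ M := Finset.sum_le_sum fun q _ => h2 q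
    _ = Fintype.card (Plaquette d L) * (2 * T) * (lam / T) ^ M := by
        rw [Finset.sum_const, Finset.card_univ, nsmul_eq_mul]
        ring

end PeierlsPow

/-! ### Partition sums lie in `[1, 2]` -/

section Partition

variable {d L : ℕ} [NeZero L] {A : Type*} [AddCommGroup A] [Fintype A] [DecidableEq A]

/-- `1 ≤ Z_closed`. -/
theorem one_le_sum_closed {φ : A → ℝ} (hφ0 : φ 0 = 1) (hφ : ∀ a, 0 ≤ φ a) :
    1 ≤ ∑ η ∈ Closed d L A, Wt φ η :=
  calc (1 : ℝ) = Wt φ (0 : Plaquette d L → A) := (Wt_zero hφ0).symm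
    _ ≤ _ := Finset.single_le_sum (f := fun η => Wt φ η) (fun η _ => Wt_nonneg hφ η)
        (mem_Closed.2 isClosedPl_zero)

/-- **`Z_closed ≤ 2`** once the Peierls sum `δ(|A|ε, 1) ≤ 1/2`: every non-zero closed
configuration has a component, so `Z_closed ≤ 1 + Z_closed · δ(|A|ε, 1)`. -/
theorem sum_closed_le_two {φ : A → ℝ} (hφ0 : φ 0 = 1) (hφ : ∀ a, 0 ≤ φ a) {ε : ℝ} (hε0 : 0 ≤ ε)
    (hε : ∀ a, a ≠ 0 → φ a ≤ ε) (hPS : peierlsSum d L (Fintype.card A * ε) 1 ≤ 1 / 2) :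
    ∑ η ∈ Closed d L A, Wt φ η ≤ 2 := by
  classical
  set Z := ∑ η ∈ Closed d L A, Wt φ η with hZ
  have hsplit : Z = Wt φ (0 : Plaquette d L → A) + ∑ η ∈ (Closed d L A).erase 0, Wt φ η :=
    (Finset.add_sum_erase _ (fun η => Wt φ η) (mem_Closed.2 isClosedPl_zero)).symm
  have hsub : (Closed d L A).erase 0 ⊆
      (Closed d L A).filter (fun η => ∃ C ∈ rcomponents CubeAdj (psupp η), 1 ≤ C.card) := by
    intro η hη
    obtain ⟨hne, hcl⟩ := Finset.mem_erase.1 hη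
    refine Finset.mem_filter.2 ⟨hcl, ?_⟩
    obtain ⟨p, hp⟩ : ∃ p, η p ≠ 0 := by
      by_contra h
      push Not at h
      exact hne (funext h)
    exact ⟨rcomponent CubeAdj (psupp η) p, mem_rcomponents_iff.2 ⟨p, mem_psupp.2 hp, rfl⟩,
      Finset.card_pos.2 ⟨p, mem_rcomponent_self (mem_psupp.2 hp)⟩⟩
  have hbig := sum_closed_bigComponent_le (d := d) (L := L) hφ0 hφ hε0 hε 1
  have h1 : ∑ η ∈ (Closed d L A).erase 0, Wt φ η ≤ Z * peierlsSum d L (Fintype.card A * ε) 1 :=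
    (Finset.sum_le_sum_of_subset_of_nonneg hsub (fun η _ _ => Wt_nonneg hφ η)).trans hbig
  have hZ0 : 0 ≤ Z := Finset.sum_nonneg fun η _ => Wt_nonneg hφ η
  rw [Wt_zero hφ0] at hsplit
  nlinarith [mul_le_mul_of_nonneg_left hPS hZ0]

variable {G : Type*} [CommGroup G] [Fintype G] [DecidableEq G]

/-- `1 ≤ Z_exact` (the trivial configuration is exact). -/
theorem one_le_sum_Img {φ : Additive G → ℝ} (hφ0 : φ 0 = 1) (hφ : ∀ a, 0 ≤ φ a) :
    1 ≤ ∑ η ∈ Img d L G, Wt φ η :=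
  calc (1 : ℝ) = Wt φ (0 : Plaquette d L → Additive G) := (Wt_zero hφ0).symm
    _ ≤ _ := Finset.single_le_sum (f := fun η => Wt φ η) (fun η _ => Wt_nonneg hφ η)
        (Finset.mem_image.2 ⟨1, Finset.mem_univ _, plaqField_one⟩)

/-- `Z_exact ≤ Z_closed` (exact configurations are closed). -/
theorem sum_Img_le_sum_closed {φ : Additive G → ℝ} (hφ : ∀ a, 0 ≤ φ a) :
    ∑ η ∈ Img d L G, Wt φ η ≤ ∑ η ∈ Closed d L (Additive G), Wt φ η :=
  Finset.sum_le_sum_of_subset_of_nonneg Img_subset_Closed fun η _ _ => Wt_nonneg hφ η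

end Partition

/-! ### One non-zero face of a closed configuration forces another one on the same `3`-cell -/

section Faces

variable {d L : ℕ} {A : Type*} [AddCommGroup A]

/-- Non-zero on the face `(x; i,j)` of the cell `(x; i<j<k)` ⇒ non-zero on another face. -/
theorem ne_zero_face₅ {η : Plaquette d L → A} (hη : IsClosedPl η) (x : Site d L) {i j k : Fin d}
    (hij : i < j) (hjk : j < k) (h : η (x, ⟨(i, j), hij⟩) ≠ 0) :
    η (x, ⟨(j, k), hjk⟩) ≠ 0 ∨ η (x + te i, ⟨(j, k), hjk⟩) ≠ 0 ∨
      η (x, ⟨(i, k), hij.trans hjk⟩) ≠ 0 ∨ η (x + te j, ⟨(i, k), hij.trans hjk⟩) ≠ 0 ∨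
        η (x + te k, ⟨(i, j), hij⟩) ≠ 0 := by
  by_contra hall
  push Not at hall
  obtain ⟨h1, h2, h3, h4, h6⟩ := hall
  have hc := hη x i j k
  rw [td₂_ext_sorted η x hij hjk, h1, h2, h3, h4, h6] at hc
  apply h
  simpa using hc

/-- Non-zero on the face `(x + e_k; i,j)` ⇒ non-zero on another face of `(x; i<j<k)`. -/
theorem ne_zero_face₆ {η : Plaquette d L → A} (hη : IsClosedPl η) (x : Site d L) {i j k : Fin d}
    (hij : i < j) (hjk : j < k) (h : η (x + te k, ⟨(i, j), hij⟩) ≠ 0) :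
    η (x, ⟨(j, k), hjk⟩) ≠ 0 ∨ η (x + te i, ⟨(j, k), hjk⟩) ≠ 0 ∨
      η (x, ⟨(i, k), hij.trans hjk⟩) ≠ 0 ∨ η (x + te j, ⟨(i, k), hij.trans hjk⟩) ≠ 0 ∨
        η (x, ⟨(i, j), hij⟩) ≠ 0 := by
  by_contra hall
  push Not at hall
  obtain ⟨h1, h2, h3, h4, h5⟩ := hall
  have hc := hη x i j k
  rw [td₂_ext_sorted η x hij hjk, h1, h2, h3, h4, h5] at hc
  apply h
  simpa using hc

/-- Non-zero on the face `(x; i,k)` ⇒ non-zero on another face of `(x; i<j<k)`. -/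
theorem ne_zero_face₃ {η : Plaquette d L → A} (hη : IsClosedPl η) (x : Site d L) {i j k : Fin d}
    (hij : i < j) (hjk : j < k) (h : η (x, ⟨(i, k), hij.trans hjk⟩) ≠ 0) :
    η (x, ⟨(j, k), hjk⟩) ≠ 0 ∨ η (x + te i, ⟨(j, k), hjk⟩) ≠ 0 ∨
      η (x + te j, ⟨(i, k), hij.trans hjk⟩) ≠ 0 ∨ η (x, ⟨(i, j), hij⟩) ≠ 0 ∨
        η (x + te k, ⟨(i, j), hij⟩) ≠ 0 := by
  by_contra hall
  push Not at hall
  obtain ⟨h1, h2, h4, h5, h6⟩ := hall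
  have hc := hη x i j k
  rw [td₂_ext_sorted η x hij hjk, h1, h2, h4, h5, h6] at hc
  apply h
  simpa using hc

/-- Non-zero on the face `(x + e_j; i,k)` ⇒ non-zero on another face of `(x; i<j<k)`. -/
theorem ne_zero_face₄ {η : Plaquette d L → A} (hη : IsClosedPl η) (x : Site d L) {i j k : Fin d}
    (hij : i < j) (hjk : j < k) (h : η (x + te j, ⟨(i, k), hij.trans hjk⟩) ≠ 0) :
    η (x, ⟨(j, k), hjk⟩) ≠ 0 ∨ η (x + te i, ⟨(j, k), hjk⟩) ≠ 0 ∨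
      η (x, ⟨(i, k), hij.trans hjk⟩) ≠ 0 ∨ η (x, ⟨(i, j), hij⟩) ≠ 0 ∨
        η (x + te k, ⟨(i, j), hij⟩) ≠ 0 := by
  by_contra hall
  push Not at hall
  obtain ⟨h1, h2, h3, h5, h6⟩ := hall
  have hc := hη x i j k
  rw [td₂_ext_sorted η x hij hjk, h1, h2, h3, h5, h6] at hc
  apply h
  simpa using hc

end Faces

/-! ### Counting a component from disjoint regions it meets -/

section Regions

/-- A finite set meeting each of `m` pairwise disjoint regions has at least `m` elements. -/
theorem le_card_of_meets_disjoint_regions {α : Type*} [DecidableEq α] {m : ℕ}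
    (R : Fin m → Finset α) (C : Finset α) (hdisj : ∀ i j, i ≠ j → Disjoint (R i) (R j))
    (hne : ∀ i, ∃ x ∈ R i, x ∈ C) : m ≤ C.card := by
  have hne' : ∀ i, (C ∩ R i).Nonempty := fun i => by
    obtain ⟨x, hxR, hxC⟩ := hne i
    exact ⟨x, Finset.mem_inter.2 ⟨hxC, hxR⟩⟩
  calc m = ∑ _i : Fin m, 1 := by simp
    _ ≤ ∑ i : Fin m, (C ∩ R i).card := Finset.sum_le_sum fun i _ => Finset.card_pos.2 (hne' i)
    _ = (Finset.univ.biUnion fun i => C ∩ R i).card :=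
        (Finset.card_biUnion fun i _ j _ hij =>
          (hdisj i j hij).mono Finset.inter_subset_right Finset.inter_subset_right).symm
    _ ≤ C.card := Finset.card_le_card (Finset.biUnion_subset.2 fun i _ => Finset.inter_subset_left)

/-- List form: a finite set meeting each member of a pairwise disjoint list of regions has at
least as many elements as the list. -/
theorem le_card_of_meets_disjoint_list {α : Type*} [DecidableEq α] (Rs : List (Finset α))
    (C : Finset α) (hdisj : Rs.Pairwise (fun s t => Disjoint s t))
    (hne : ∀ R ∈ Rs, ∃ x ∈ R, x ∈ C) : Rs.length ≤ C.card := by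
  have hget := List.pairwise_iff_get.1 hdisj
  refine le_card_of_meets_disjoint_regions (fun i => Rs.get i) C (fun i j hij => ?_)
    (fun i => hne _ (List.get_mem Rs i))
  rcases lt_or_gt_of_ne hij with h | h
  · exact hget i j h
  · exact (hget j i h).symm

end Regions


end Summit.QuantumFields.YangMills.Theorems.FemtoCurvatureTwoPoint.Negative.FiniteGroupPeierls

end
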